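import Summits.ResolutionOfSingularities.ResolutionOfSingularities.Theorems.RadicialJungCleanModelsStubCossartPiltant2019Leaves
import Literature.AlgebraicGeometry.Resolution.ArithmeticalThreefoldsDescentHeadChoice
import HarnessLib

/-!
# `CleanModels`, stub 2 (F-02): the leaf list AT CHARACTERISTIC `p`, WITHOUT Hironaka's theorem, in kernel

OURS (decomp-res hand-1 g17; crux `stmt-ResolutionOfSingularities-15917`, skeleton rev 35 `Cruxes/CleanModels/Lines/Sketch.lean`,
stub `stub_cossartPiltant2019 : CossartPiltant2019.{0}`). A BOOKKEEPING file continuing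
`RadicialJungCleanModelsStubCossartPiltant2019Leaves{,RankOne}.lean`.

The crux `CleanModels` lives over a ground field `k` of characteristic `p > 0`, but its stub 2 is typed as the named fact
`CossartPiltant2019.{0}` — resolution of threefolds over EVERY field, including characteristic zero — so its leaf list along
Cossart–Piltant's architecture carries `Hironaka1964_local` (Hironaka 1964 / Temkin 2008 for local quasi-excellent rings of residue
characteristic zero), idle for the crux.  The tree's architecture is ALREADY per residue characteristic where it matters:
`CossartPiltant2019ReductionP` (proof of CP 2019 Prop. 4.10) gives (LU) for complete local domains of dimension three with residue
field of characteristic `p`, and the patching `CossartPiltant2019Patching` (PROVED, `CossartPiltant2019Patching_holds`) is stated field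
by field.  With hand-1 g17's per-field, rank-one, `∃`-form descent (`localUniformization3_of_headChoiceRankOne`,
`ArithmeticalThreefoldsDescentHeadChoice.lean`) the whole chain runs at fixed characteristic `p`:

* `localUniformization3_of_stub1_of_leaves_charP` — for a prime `p` and a field `k` of characteristic `p`: `LocalUniformization3 k`
  from `CossartPiltant2019Local` (CP Thm. 1.5), `CossartJannsenSaito2020Embedded.{0}` (= the TYPE of stub 1), `hEqT`, `hEqI` (research,
  verbatim as in `cossartPiltant2019_of_stub1_of_leaves`) and the geometric head of CP Prop. 4.8 for the local rings `B_𝔭` of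
  three-dimensional `k`-domains ALONG RANK-ONE VALUATIONS, in `∃`-form, the head being allowed to use (LU) for complete local domains
  of dimension three WITH RESIDUE FIELD OF CHARACTERISTIC `p` only (which is what `CossartPiltant2019ReductionP` delivers from the
  local theorem) — **no `Hironaka1964_local`**;
* `resolutionOverUpToDim_three_of_stub1_of_leaves_charP` — hence weak resolution of reduced separated `k`-schemes of finite type of
  dimension `≤ 3` (`ResolutionOverUpToDim k 3`, the `k`-instance of F-02) from the same leaves, by the PROVED patching;
(The all-fields statement `CossartPiltant2019.{0}` — the literal type of stub 2 — from the same leaves PLUS `Hironaka1964_local`,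
with the head in `∃`-form at rank one, is `cossartPiltant2019_of_stub1_of_leaves_headChoiceRankOne` in
`RadicialJungCleanModelsStubCossartPiltant2019LeavesRankOne.lean`.)

For the line lead: re-typing stub 2 as `∀ k, CharP k p → ResolutionOverUpToDim.{0} k 3 ∧ LocalUniformization3.{0} k` (what the
consumers `CossartPiltant2019.lu3` / `hasResolution_of_dim_le_three` use at the crux's `k`) would drop `Hironaka1964_local` from the
crux's trust base; this file is the kernel source for such a reshape.  Nothing here proves resolution of singularities in positive
characteristic, local uniformization, or any statement of a manuscript under adjudication. AI-written; AI review weaker than expert review.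
-/

-- `Summit.<Summit>.<Sub>.Theorems` with `Sub = Summit` (single-conjunct summit, D-0017)
set_option linter.dupNamespace false

noncomputable section

open IsLocalRing Polynomial
open Literature.AlgebraicGeometry.Resolution
open Summit.ResolutionOfSingularities.ResolutionOfSingularities.Theorems.CP2008Prop44

namespace Summit.ResolutionOfSingularities.ResolutionOfSingularities.Theorems.RadicialJung.CleanModels

/-- **Local uniformization in dimension three over a field of characteristic `p`, from stub 1 + the named residue, WITHOUT
Hironaka's theorem** (hand-1 g17).  For a prime `p` and a field `k` with `CharP k p`: `LocalUniformization3 k` from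
`CossartPiltant2019Local` (CP 2019 Thm. 1.5), `CossartJannsenSaito2020Embedded.{0}` (CJS Thm. 1.4 with `B = ∅`, the type of stub 1),
the equivariant local uniformizations `hEqT`, `hEqI` (not in print; verbatim the hypotheses of
`cossartPiltant2019ReductionP_of_embPrinted_of_equivariantLU_split`), and the geometric head of CP 2019 Prop. 4.8 (Thm. 1.1 for
`Spec Â` + Lemma 4.7 + density) for the local rings `B_𝔭` at maximal ideals of three-dimensional domains `B` of finite type over `k`,
ALONG RANK-ONE VALUATIONS and in `∃`-form (the prover chooses the formal branch and the extension `v̂`), the head being allowed to use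
(LU) for complete Noetherian local domains of dimension three whose residue field has characteristic `p`.  Chain:
`cossartPiltant2019ReductionP_of_embPrinted_of_equivariantLU_split` (Prop. 4.10, principalization discharged) ⟶ (LU) for complete
local domains of residue characteristic `p` ⟶ head ⟶ `localUniformization3_of_headChoiceRankOne` (Novacoski–Spivakovsky in
transcendence degree `≤ 3`, closed points, pointwise descent tail) with surface resolution from `cossartJannsenSaito2020_of_embedded`.
[cite: CossartPiltant2019, Thm. 1.5, Props. 4.4, 4.6, 4.8 with Lemma 4.7, 4.10] [cite: CossartPiltant2008, Prop. 8.1, Prop. 9.3, Lemma 9.4]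
[cite: CossartJannsenSaito2020, Thm. 1.2, Thm. 1.4] [cite: NovacoskiSpivakovsky2014, Thm. 1.1] -/
theorem localUniformization3_of_stub1_of_leaves_charP (p : ℕ) (hp : p.Prime)
    (hloc : CossartPiltant2019Local.{0}) (hCJSE : CossartJannsenSaito2020Embedded.{0})
    (hEqT :
      ∀ (p : ℕ), p.Prime →
      ∀ (S : Type) [CommRing S] [IsDomain S] [IsRegularLocalRing S],
        IsExcellentRing S → ringKrullDim S = 3 → CharP (ResidueField S) p →
        IsAdicComplete (maximalIdeal S) S →
      ∀ (E : Type) [Field E] [Algebra S E], Function.Injective (algebraMap S E) →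
        IsAlgClosed E → Algebra.IsAlgebraic S E →
      ∀ (OE : ValuationSubring E), (∀ s : S, algebraMap S E s ∈ OE) →
        (∀ s ∈ maximalIdeal S, OE.valuation (algebraMap S E s) < 1) →
        (∀ y : OE, ∃ q : S[X], (∃ i, q.coeff i ∉ maximalIdeal S) ∧
          OE.valuation (q.eval₂ (algebraMap S E) y) < 1) →
      Nonempty OE.valuation.RankOne →
      ∀ (M' : Subfield E), (∀ s : S, algebraMap S E s ∈ M') →
      ∀ (H : Subgroup (E ≃ₐ[S] E)),
        (∀ σ ∈ H, ∀ x ∈ M', σ x ∈ M') →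
        (∀ σ ∈ H, ∀ x ∈ M', x ∈ OE → σ x ∈ OE) →
        (∀ σ ∈ H, ∀ x ∈ M', x ∈ OE → OE.valuation (σ x - x) < 1) →
        (∃ ℓ : ℕ, ℓ.Prime ∧ ℓ ≠ p ∧ ∀ σ ∈ H, ∀ x ∈ M', (σ ^ ℓ) x = x) →
        (∀ σ ∈ H, (∃ x ∈ M', σ x ≠ x) →
          ∃ x ∈ M', x ≠ 0 ∧ OE.valuation (σ x - x) = OE.valuation x) →
        (∃ t : Finset E, (t : Set E) ⊆ M' ∧
          M' ≤ Subfield.closure (Set.range (algebraMap S E) ∪ (t : Set E)) ∧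
          ∃ hTO : (Algebra.adjoin S (t : Set E)).toSubring ≤ OE.toSubring,
            IsRegularLocalRing (Localization.AtPrime
              (Ideal.comap (Subring.inclusion hTO) (maximalIdeal OE)))) →
        ∃ t : Finset E, (t : Set E) ⊆ M' ∧
          M' ≤ Subfield.closure (Set.range (algebraMap S E) ∪ (t : Set E)) ∧
          ∃ hTO : (Algebra.adjoin S (t : Set E)).toSubring ≤ OE.toSubring,
            IsRegularLocalRing (Localization.AtPrime
              (Ideal.comap (Subring.inclusion hTO) (maximalIdeal OE))) ∧
            (∀ σ ∈ H, ∀ x ∈ locAtCentre (Algebra.adjoin S (t : Set E)).toSubring OE,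
              σ x ∈ locAtCentre (Algebra.adjoin S (t : Set E)).toSubring OE))
    (hEqI :
      ∀ (p : ℕ), p.Prime →
      ∀ (S : Type) [CommRing S] [IsDomain S] [IsRegularLocalRing S],
        IsExcellentRing S → ringKrullDim S = 3 → CharP (ResidueField S) p →
        IsAdicComplete (maximalIdeal S) S →
      ∀ (E : Type) [Field E] [Algebra S E], Function.Injective (algebraMap S E) →
        IsAlgClosed E → Algebra.IsAlgebraic S E →
      ∀ (OE : ValuationSubring E), (∀ s : S, algebraMap S E s ∈ OE) →
        (∀ s ∈ maximalIdeal S, OE.valuation (algebraMap S E s) < 1) →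
        (∀ y : OE, ∃ q : S[X], (∃ i, q.coeff i ∉ maximalIdeal S) ∧
          OE.valuation (q.eval₂ (algebraMap S E) y) < 1) →
      Nonempty OE.valuation.RankOne →
      ∀ (M' : Subfield E), (∀ s : S, algebraMap S E s ∈ M') →
      ∀ (H : Subgroup (E ≃ₐ[S] E)),
        (∀ σ ∈ H, ∀ x ∈ M', σ x ∈ M') →
        (∀ σ ∈ H, ∀ x ∈ M', x ∈ OE → σ x ∈ OE) →
        (∀ σ ∈ H, (∃ x ∈ M', σ x ≠ x) →
          ∃ x ∈ M', OE.valuation x = 1 ∧ OE.valuation (σ x - x) = 1) →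
      ∀ (x₀ : E), x₀ ∈ M' → x₀ ∈ OE →
        (∃ t : Finset E, (t : Set E) ⊆ M' ∧
          M' ≤ Subfield.closure (Set.range (algebraMap S E) ∪ (t : Set E)) ∧
          ∃ hTO : (Algebra.adjoin S (t : Set E)).toSubring ≤ OE.toSubring,
            IsRegularLocalRing (Localization.AtPrime
              (Ideal.comap (Subring.inclusion hTO) (maximalIdeal OE)))) →
        ∃ t : Finset E, (t : Set E) ⊆ M' ∧
          M' ≤ Subfield.closure (Set.range (algebraMap S E) ∪ (t : Set E)) ∧
          ∃ hTO : (Algebra.adjoin S (t : Set E)).toSubring ≤ OE.toSubring,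
            IsRegularLocalRing (Localization.AtPrime
              (Ideal.comap (Subring.inclusion hTO) (maximalIdeal OE))) ∧
            (∀ σ ∈ H, ∀ x ∈ locAtCentre (Algebra.adjoin S (t : Set E)).toSubring OE,
              σ x ∈ locAtCentre (Algebra.adjoin S (t : Set E)).toSubring OE) ∧
            x₀ ∈ locAtCentre (Algebra.adjoin S (t : Set E)).toSubring OE)
    (hhead : (∀ (A : Type) [CommRing A] [IsDomain A] [IsLocalRing A] [IsNoetherianRing A]
        [IsAdicComplete (maximalIdeal A) A],
        ringKrullDim A = 3 → CharP (ResidueField A) p → CPLocalUniformization A) →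
      ∀ (k : Type) [Field k] [CharP k p],
      ∀ (B : Type) [CommRing B] [IsDomain B] [Algebra k B] [Algebra.FiniteType k B]
          (𝔭 : Ideal B) [𝔭.IsMaximal], ringKrullDim B = 3 →
          ringKrullDim (Localization.AtPrime 𝔭) = 3 →
        ∀ (K : Type) [Field K] [Algebra (Localization.AtPrime 𝔭) K]
          [IsFractionRing (Localization.AtPrime 𝔭) K] (O : ValuationSubring K),
        Nonempty O.valuation.RankOne →
        (∀ x : Localization.AtPrime 𝔭, algebraMap _ K x ∈ O) →
        (∀ x ∈ maximalIdeal (Localization.AtPrime 𝔭), O.valuation (algebraMap _ K x) < 1) →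
        (∀ y : O, ∃ q : Polynomial (Localization.AtPrime 𝔭),
          (∃ i, q.coeff i ∉ maximalIdeal (Localization.AtPrime 𝔭)) ∧
          O.valuation (q.eval₂ (algebraMap _ K) y) < 1) →
        ∃ (K₁ : Type) (_ : Field K₁)
          (_ : Algebra (AdicCompletion (maximalIdeal (Localization.AtPrime 𝔭))
            (Localization.AtPrime 𝔭)) K₁),
          RingHom.ker (algebraMap (AdicCompletion (maximalIdeal (Localization.AtPrime 𝔭))
            (Localization.AtPrime 𝔭)) K₁) ∈
            minimalPrimes (AdicCompletion (maximalIdeal (Localization.AtPrime 𝔭))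
              (Localization.AtPrime 𝔭)) ∧
          (∀ z : K₁, ∃ a b : AdicCompletion (maximalIdeal (Localization.AtPrime 𝔭))
            (Localization.AtPrime 𝔭), z = algebraMap _ K₁ a / algebraMap _ K₁ b) ∧
          ∃ (ι : K →+* K₁), ι.comp (algebraMap (Localization.AtPrime 𝔭) K) =
            (algebraMap (AdicCompletion (maximalIdeal (Localization.AtPrime 𝔭))
              (Localization.AtPrime 𝔭)) K₁).comp (algebraMap (Localization.AtPrime 𝔭) _) ∧
          ∃ (O' : ValuationSubring K₁),
            (∀ y : O', ∃ q : Polynomial (AdicCompletion (maximalIdeal (Localization.AtPrime 𝔭))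
              (Localization.AtPrime 𝔭)),
              (∃ i, q.coeff i ∉ (maximalIdeal (Localization.AtPrime 𝔭)).map
                (algebraMap (Localization.AtPrime 𝔭)
                  (AdicCompletion (maximalIdeal (Localization.AtPrime 𝔭)) (Localization.AtPrime 𝔭)))) ∧
              O'.valuation (q.eval₂ (algebraMap _ K₁) y) < 1) ∧
            O'.comap ι = O ∧
            ∃ (S : Type) (_ : CommRing S) (_ : IsRegularLocalRing S)
              (_ : Algebra (AdicCompletion (maximalIdeal (Localization.AtPrime 𝔭))
                (Localization.AtPrime 𝔭)) S) (_ : Algebra S K₁),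
              IsLocalHom (algebraMap (AdicCompletion (maximalIdeal (Localization.AtPrime 𝔭))
                (Localization.AtPrime 𝔭)) S) ∧
              Algebra.EssFiniteType (AdicCompletion (maximalIdeal (Localization.AtPrime 𝔭))
                (Localization.AtPrime 𝔭)) S ∧
              IsScalarTower (AdicCompletion (maximalIdeal (Localization.AtPrime 𝔭))
                (Localization.AtPrime 𝔭)) S K₁ ∧
              Function.Injective (algebraMap S K₁) ∧
              (∀ s : S, algebraMap S K₁ s ∈ O') ∧
              (∀ s ∈ maximalIdeal S, O'.valuation (algebraMap S K₁ s) < 1) ∧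
              ∃ (d : ℕ) (z : Fin d → S) (a : Fin d → ℕ) (c : Fin d → Sˣ) (g : Fin d → K),
                Ideal.span (Set.range z) = maximalIdeal S ∧ (∀ j, 0 < a j) ∧
                ∀ j, ι (g j) = algebraMap S K₁ (c j * z j ^ a j))
    (k : Type) [Field k] [CharP k p] : LocalUniformization3 k :=
  localUniformization3_of_headChoiceRankOne (cossartJannsenSaito2020_of_embedded hCJSE) k
    (hhead (fun A _ _ _ _ _ hdim hchar =>
      cossartPiltant2019ReductionP_of_embPrinted_of_equivariantLU_split hloc
        CossartPiltant2019Principalization_holds hCJSE hEqT hEqI hloc p hp A hdim hchar) k)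

/-- **Weak resolution of threefolds over a field of characteristic `p` from stub 1 + the named residue, WITHOUT Hironaka's
theorem** (hand-1 g17): for a prime `p` and a field `k` with `CharP k p`, every reduced separated `k`-scheme of finite type of
dimension `≤ 3` has a resolution of singularities (`ResolutionOverUpToDim k 3`, the `k`-instance of F-02 `CossartPiltant2019`), from
the leaves of `localUniformization3_of_stub1_of_leaves_charP`, by the PROVED enhanced Zariski patching
(`CossartPiltant2019Patching_holds`, CP 2019 Prop. 4.6) fed with surface resolution over `k` (`cossartJannsenSaito2020_of_embedded`)
and `LocalUniformization3 k`.
[cite: CossartPiltant2019, Thm. 1.1, Thm. 1.5, Props. 4.4, 4.6, 4.8, 4.10] [cite: CossartJannsenSaito2020, Thm. 1.2, Thm. 1.4]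
[cite: NovacoskiSpivakovsky2014, Thm. 1.1] -/
theorem resolutionOverUpToDim_three_of_stub1_of_leaves_charP (p : ℕ) (hp : p.Prime)
    (hloc : CossartPiltant2019Local.{0}) (hCJSE : CossartJannsenSaito2020Embedded.{0})
    (hEqT :
      ∀ (p : ℕ), p.Prime →
      ∀ (S : Type) [CommRing S] [IsDomain S] [IsRegularLocalRing S],
        IsExcellentRing S → ringKrullDim S = 3 → CharP (ResidueField S) p →
        IsAdicComplete (maximalIdeal S) S →
      ∀ (E : Type) [Field E] [Algebra S E], Function.Injective (algebraMap S E) →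
        IsAlgClosed E → Algebra.IsAlgebraic S E →
      ∀ (OE : ValuationSubring E), (∀ s : S, algebraMap S E s ∈ OE) →
        (∀ s ∈ maximalIdeal S, OE.valuation (algebraMap S E s) < 1) →
        (∀ y : OE, ∃ q : S[X], (∃ i, q.coeff i ∉ maximalIdeal S) ∧
          OE.valuation (q.eval₂ (algebraMap S E) y) < 1) →
      Nonempty OE.valuation.RankOne →
      ∀ (M' : Subfield E), (∀ s : S, algebraMap S E s ∈ M') →
      ∀ (H : Subgroup (E ≃ₐ[S] E)),
        (∀ σ ∈ H, ∀ x ∈ M', σ x ∈ M') →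
        (∀ σ ∈ H, ∀ x ∈ M', x ∈ OE → σ x ∈ OE) →
        (∀ σ ∈ H, ∀ x ∈ M', x ∈ OE → OE.valuation (σ x - x) < 1) →
        (∃ ℓ : ℕ, ℓ.Prime ∧ ℓ ≠ p ∧ ∀ σ ∈ H, ∀ x ∈ M', (σ ^ ℓ) x = x) →
        (∀ σ ∈ H, (∃ x ∈ M', σ x ≠ x) →
          ∃ x ∈ M', x ≠ 0 ∧ OE.valuation (σ x - x) = OE.valuation x) →
        (∃ t : Finset E, (t : Set E) ⊆ M' ∧
          M' ≤ Subfield.closure (Set.range (algebraMap S E) ∪ (t : Set E)) ∧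
          ∃ hTO : (Algebra.adjoin S (t : Set E)).toSubring ≤ OE.toSubring,
            IsRegularLocalRing (Localization.AtPrime
              (Ideal.comap (Subring.inclusion hTO) (maximalIdeal OE)))) →
        ∃ t : Finset E, (t : Set E) ⊆ M' ∧
          M' ≤ Subfield.closure (Set.range (algebraMap S E) ∪ (t : Set E)) ∧
          ∃ hTO : (Algebra.adjoin S (t : Set E)).toSubring ≤ OE.toSubring,
            IsRegularLocalRing (Localization.AtPrime
              (Ideal.comap (Subring.inclusion hTO) (maximalIdeal OE))) ∧
            (∀ σ ∈ H, ∀ x ∈ locAtCentre (Algebra.adjoin S (t : Set E)).toSubring OE,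
              σ x ∈ locAtCentre (Algebra.adjoin S (t : Set E)).toSubring OE))
    (hEqI :
      ∀ (p : ℕ), p.Prime →
      ∀ (S : Type) [CommRing S] [IsDomain S] [IsRegularLocalRing S],
        IsExcellentRing S → ringKrullDim S = 3 → CharP (ResidueField S) p →
        IsAdicComplete (maximalIdeal S) S →
      ∀ (E : Type) [Field E] [Algebra S E], Function.Injective (algebraMap S E) →
        IsAlgClosed E → Algebra.IsAlgebraic S E →
      ∀ (OE : ValuationSubring E), (∀ s : S, algebraMap S E s ∈ OE) →
        (∀ s ∈ maximalIdeal S, OE.valuation (algebraMap S E s) < 1) →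
        (∀ y : OE, ∃ q : S[X], (∃ i, q.coeff i ∉ maximalIdeal S) ∧
          OE.valuation (q.eval₂ (algebraMap S E) y) < 1) →
      Nonempty OE.valuation.RankOne →
      ∀ (M' : Subfield E), (∀ s : S, algebraMap S E s ∈ M') →
      ∀ (H : Subgroup (E ≃ₐ[S] E)),
        (∀ σ ∈ H, ∀ x ∈ M', σ x ∈ M') →
        (∀ σ ∈ H, ∀ x ∈ M', x ∈ OE → σ x ∈ OE) →
        (∀ σ ∈ H, (∃ x ∈ M', σ x ≠ x) →
          ∃ x ∈ M', OE.valuation x = 1 ∧ OE.valuation (σ x - x) = 1) →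
      ∀ (x₀ : E), x₀ ∈ M' → x₀ ∈ OE →
        (∃ t : Finset E, (t : Set E) ⊆ M' ∧
          M' ≤ Subfield.closure (Set.range (algebraMap S E) ∪ (t : Set E)) ∧
          ∃ hTO : (Algebra.adjoin S (t : Set E)).toSubring ≤ OE.toSubring,
            IsRegularLocalRing (Localization.AtPrime
              (Ideal.comap (Subring.inclusion hTO) (maximalIdeal OE)))) →
        ∃ t : Finset E, (t : Set E) ⊆ M' ∧
          M' ≤ Subfield.closure (Set.range (algebraMap S E) ∪ (t : Set E)) ∧
          ∃ hTO : (Algebra.adjoin S (t : Set E)).toSubring ≤ OE.toSubring,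
            IsRegularLocalRing (Localization.AtPrime
              (Ideal.comap (Subring.inclusion hTO) (maximalIdeal OE))) ∧
            (∀ σ ∈ H, ∀ x ∈ locAtCentre (Algebra.adjoin S (t : Set E)).toSubring OE,
              σ x ∈ locAtCentre (Algebra.adjoin S (t : Set E)).toSubring OE) ∧
            x₀ ∈ locAtCentre (Algebra.adjoin S (t : Set E)).toSubring OE)
    (hhead : (∀ (A : Type) [CommRing A] [IsDomain A] [IsLocalRing A] [IsNoetherianRing A]
        [IsAdicComplete (maximalIdeal A) A],
        ringKrullDim A = 3 → CharP (ResidueField A) p → CPLocalUniformization A) →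
      ∀ (k : Type) [Field k] [CharP k p],
      ∀ (B : Type) [CommRing B] [IsDomain B] [Algebra k B] [Algebra.FiniteType k B]
          (𝔭 : Ideal B) [𝔭.IsMaximal], ringKrullDim B = 3 →
          ringKrullDim (Localization.AtPrime 𝔭) = 3 →
        ∀ (K : Type) [Field K] [Algebra (Localization.AtPrime 𝔭) K]
          [IsFractionRing (Localization.AtPrime 𝔭) K] (O : ValuationSubring K),
        Nonempty O.valuation.RankOne →
        (∀ x : Localization.AtPrime 𝔭, algebraMap _ K x ∈ O) →
        (∀ x ∈ maximalIdeal (Localization.AtPrime 𝔭), O.valuation (algebraMap _ K x) < 1) →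
        (∀ y : O, ∃ q : Polynomial (Localization.AtPrime 𝔭),
          (∃ i, q.coeff i ∉ maximalIdeal (Localization.AtPrime 𝔭)) ∧
          O.valuation (q.eval₂ (algebraMap _ K) y) < 1) →
        ∃ (K₁ : Type) (_ : Field K₁)
          (_ : Algebra (AdicCompletion (maximalIdeal (Localization.AtPrime 𝔭))
            (Localization.AtPrime 𝔭)) K₁),
          RingHom.ker (algebraMap (AdicCompletion (maximalIdeal (Localization.AtPrime 𝔭))
            (Localization.AtPrime 𝔭)) K₁) ∈
            minimalPrimes (AdicCompletion (maximalIdeal (Localization.AtPrime 𝔭))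
              (Localization.AtPrime 𝔭)) ∧
          (∀ z : K₁, ∃ a b : AdicCompletion (maximalIdeal (Localization.AtPrime 𝔭))
            (Localization.AtPrime 𝔭), z = algebraMap _ K₁ a / algebraMap _ K₁ b) ∧
          ∃ (ι : K →+* K₁), ι.comp (algebraMap (Localization.AtPrime 𝔭) K) =
            (algebraMap (AdicCompletion (maximalIdeal (Localization.AtPrime 𝔭))
              (Localization.AtPrime 𝔭)) K₁).comp (algebraMap (Localization.AtPrime 𝔭) _) ∧
          ∃ (O' : ValuationSubring K₁),
            (∀ y : O', ∃ q : Polynomial (AdicCompletion (maximalIdeal (Localization.AtPrime 𝔭))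
              (Localization.AtPrime 𝔭)),
              (∃ i, q.coeff i ∉ (maximalIdeal (Localization.AtPrime 𝔭)).map
                (algebraMap (Localization.AtPrime 𝔭)
                  (AdicCompletion (maximalIdeal (Localization.AtPrime 𝔭)) (Localization.AtPrime 𝔭)))) ∧
              O'.valuation (q.eval₂ (algebraMap _ K₁) y) < 1) ∧
            O'.comap ι = O ∧
            ∃ (S : Type) (_ : CommRing S) (_ : IsRegularLocalRing S)
              (_ : Algebra (AdicCompletion (maximalIdeal (Localization.AtPrime 𝔭))
                (Localization.AtPrime 𝔭)) S) (_ : Algebra S K₁),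
              IsLocalHom (algebraMap (AdicCompletion (maximalIdeal (Localization.AtPrime 𝔭))
                (Localization.AtPrime 𝔭)) S) ∧
              Algebra.EssFiniteType (AdicCompletion (maximalIdeal (Localization.AtPrime 𝔭))
                (Localization.AtPrime 𝔭)) S ∧
              IsScalarTower (AdicCompletion (maximalIdeal (Localization.AtPrime 𝔭))
                (Localization.AtPrime 𝔭)) S K₁ ∧
              Function.Injective (algebraMap S K₁) ∧
              (∀ s : S, algebraMap S K₁ s ∈ O') ∧
              (∀ s ∈ maximalIdeal S, O'.valuation (algebraMap S K₁ s) < 1) ∧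
              ∃ (d : ℕ) (z : Fin d → S) (a : Fin d → ℕ) (c : Fin d → Sˣ) (g : Fin d → K),
                Ideal.span (Set.range z) = maximalIdeal S ∧ (∀ j, 0 < a j) ∧
                ∀ j, ι (g j) = algebraMap S K₁ (c j * z j ^ a j))
    (k : Type) [Field k] [CharP k p] : ResolutionOverUpToDim.{0} k 3 :=
  CossartPiltant2019Patching_holds k (cossartJannsenSaito2020_of_embedded hCJSE k)
    (localUniformization3_of_stub1_of_leaves_charP p hp hloc hCJSE hEqT hEqI hhead k)

end Summit.ResolutionOfSingularities.ResolutionOfSingularities.Theorems.RadicialJung.CleanModels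

end
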